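import Literature.NumberTheory.Sieve.QuadraticRootsLevelClasses
import Literature.NumberTheory.Sieve.QuadraticRootsLevelCosets
import Literature.NumberTheory.Sieve.IwaniecAlmostPrimesRootExpSum
import HarnessLib

/-!
# `T`-reduced forms in a class as primitive vectors; Hooley's fraction formula (any sign)

Topic `Literature/NumberTheory/Sieve`, continuation of `QuadraticRootsLevelForms.lean` /
`QuadraticRootsLevelClasses.lean` (roots of a quadratic congruence `↔` `T`-reduced forms, grouped
into `SL₂(ℤ)`-classes as double cosets `stab R ∖ SL₂(ℤ) ∕ ⟨T⟩`).  This file makes the double cosets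
concrete in the way C. Hooley uses them (*On the number of divisors of quadratic polynomials*,
Acta Math. 110 (1963), §6; *On the greatest prime factor of a quadratic polynomial*, Acta Math.
117 (1967), §6 (27)–(30)): a coset `ξ⟨T⟩` is the first column `v = (p, r)` of `ξ`, a primitive
vector, and the `T`-reduced form `vecForm P v = tred (P·ξ_v)` attached to it has first
coefficient the value `P(p, r)` — "if `λk = ar² + 2brs + cs²` be a typical primitive
representation of `λk` by the form, a typical value of `ν/λk` … is given by
`ν/λk = r̄/s − (ar + bs)/(s(ar² + 2brs + cs²))`" (Hooley 1967, (28)).  Everything is PROVED; no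
statement of the papers is vendored (D-0026):

* `RootForms.vecAct γ v` — the column action of `SL₂(ℤ)` on `ℤ²` (`(P·γ)(v) = P(γv)`,
  `eval_vecAct`; it preserves primitivity, `gcd_vecAct_eq_one`);
* `RootForms.vecForm P v := tred (P · colMatrix p r)` for primitive `v = (p, r)` and
  **the parametrisation**: `tred (P·ξ) = vecForm P (col ξ)` (`tred_smul_eq_vecForm`), every
  `T`-reduced form of the class is a `vecForm` (`exists_eq_vecForm_of_isTReduced`), its first
  coefficient is `P(v)` (`vecForm_a`), and **the fibres are the `stab P`-orbits**
  (`vecForm_eq_vecForm_iff`: `vecForm P v = vecForm P v' ↔ v' ∈ stab P · v`), on which `stab P`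
  acts **freely** (`eq_one_of_vecAct_eq`);
* **Hooley's fraction formula** `exp_vecForm_b_div_eq`: for primitive `(p, r)` with `r > 0` and
  `n = P(p, r) ≠ 0`, `e(h B_Q/(2A_Q)) = e(h p̄/r) · e(−h(2Ap + Br)/(2rn))` for `Q = vecForm P (p,r)`,
  `P = [A, B, C]`, `p p̄ ≡ 1 (mod r)` — from the integer identity `r·b(P·ξ_v) = 2r'n − (2Ap + Br)`
  (`ξ_v = (p p'; r r')`, `pr' − p'r = 1`), i.e. Hooley's (28) for an arbitrary middle coefficient;
  `e(h p̄/r)` is the tree's `Iwaniec1978.hooleyPhase h r p`;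
* **counting a class through a fundamental domain** (`card_orbit_inter_eq`): if `F ⊆ ℤ²` contains
  exactly one point of every `G'`-orbit in `{P > 0}` for some subgroup `G' ≤ stab P`, then
  `#(F ∩ stab P·w)` is the same for all primitive `w` with `P(w) > 0` (it is `[stab P : G']`), and
  consequently (`sum_vecForm_eq_card_mul_sum`) `∑_{v ∈ F, prim., 0 < P(v) ≤ N} f(vecForm P v) =
  m · ∑_{Q T-reduced in the class of P, 0 < A_Q ≤ N} f(Q)` with that common multiplicity `m`
  (Hooley's "only one representation from each possible set of representations is to be
  included", 1967 (30), for a domain `F` that need not be exact).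

The fundamental domains themselves (a half-plane for definite `P`, a sector cut out by a Pell
automorph for indefinite `P`) are supplied in `QuadraticRootsAllModuliDomains.lean`.

## References

* C. Hooley, Acta Math. 110 (1963), 97–114, §6. [cite: Hooley1963, §6]
* C. Hooley, Acta Math. 117 (1967), 281–299, §6 (27)–(30) (read: `paper:galaxy-pdf-699250920`,
  pp. 8–9). [cite: Hooley1967, §6 (27)–(30)]
* W. Duke, J. B. Friedlander, H. Iwaniec, Ann. of Math. 141 (1995), §2 pp. 427–428 (the classes
  and the cosets modulo `Γ∞`). [cite: DukeFriedlanderIwaniec1995, §2 (12)–(14)]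
-/

noncomputable section

namespace Literature.NumberTheory.Sieve

open scoped BigOperators MatrixGroups
open Finset
open Literature.NumberTheory.QuadraticFields.Quadratic (BinQF)
open Literature.NumberTheory.Sieve.Iwaniec1978 (hooleyPhase)

namespace RootForms

/-! ### The column action of `SL₂(ℤ)` on `ℤ²` -/

/-- The column action `v ↦ γv` of `γ = (a b; c d) ∈ SL₂(ℤ)` on `ℤ²`: `(x, y) ↦ (ax + by, cx + dy)`.
[folklore] -/
def vecAct (γ : SL(2, ℤ)) (v : ℤ × ℤ) : ℤ × ℤ :=
  (γ 0 0 * v.1 + γ 0 1 * v.2, γ 1 0 * v.1 + γ 1 1 * v.2)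

/-- Components of `vecAct`. [folklore] -/
@[simp] theorem vecAct_fst (γ : SL(2, ℤ)) (v : ℤ × ℤ) : (vecAct γ v).1 = γ 0 0 * v.1 + γ 0 1 * v.2 := rfl

/-- Components of `vecAct`. [folklore] -/
@[simp] theorem vecAct_snd (γ : SL(2, ℤ)) (v : ℤ × ℤ) : (vecAct γ v).2 = γ 1 0 * v.1 + γ 1 1 * v.2 := rfl

/-- Entries of a product in `SL₂(ℤ)`. [folklore] -/
theorem mul_apply_two (γ γ' : SL(2, ℤ)) (i j : Fin 2) :
    (γ * γ') i j = γ i 0 * γ' 0 j + γ i 1 * γ' 1 j := by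
  simp [Matrix.SpecialLinearGroup.coe_mul, Matrix.mul_apply, Fin.sum_univ_two]

/-- `1` acts trivially. [folklore] -/
@[simp] theorem vecAct_one (v : ℤ × ℤ) : vecAct 1 v = v := by
  ext <;> simp [vecAct, Matrix.SpecialLinearGroup.coe_one]

/-- `(γγ')v = γ(γ'v)`. [folklore] -/
theorem vecAct_mul (γ γ' : SL(2, ℤ)) (v : ℤ × ℤ) : vecAct (γ * γ') v = vecAct γ (vecAct γ' v) := by
  ext <;> simp only [vecAct_fst, vecAct_snd, mul_apply_two] <;> ring

/-- `(−γ)v = −(γv)`. [folklore] -/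
theorem vecAct_neg (γ : SL(2, ℤ)) (v : ℤ × ℤ) : vecAct (-γ) v = -vecAct γ v := by
  ext <;> simp [vecAct, Matrix.SpecialLinearGroup.coe_neg] <;> ring

/-- `γ⁻¹(γ v) = v`. [folklore] -/
@[simp] theorem vecAct_inv_vecAct (γ : SL(2, ℤ)) (v : ℤ × ℤ) : vecAct γ⁻¹ (vecAct γ v) = v := by
  rw [← vecAct_mul, inv_mul_cancel, vecAct_one]

/-- `γ(γ⁻¹ v) = v`. [folklore] -/
@[simp] theorem vecAct_vecAct_inv (γ : SL(2, ℤ)) (v : ℤ × ℤ) : vecAct γ (vecAct γ⁻¹ v) = v := by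
  rw [← vecAct_mul, mul_inv_cancel, vecAct_one]

/-- The first column of `γ` is `γ e₁`. [folklore] -/
theorem vecAct_e1 (γ : SL(2, ℤ)) : vecAct γ (1, 0) = (γ 0 0, γ 1 0) := by
  ext <;> simp [vecAct]

/-- The first column of `γξ` is `γ` applied to the first column of `ξ`. [folklore] -/
theorem col_mul (γ ξ : SL(2, ℤ)) : ((γ * ξ) 0 0, (γ * ξ) 1 0) = vecAct γ (ξ 0 0, ξ 1 0) := by
  ext <;> simp [vecAct, mul_apply_two]

/-- `(P·γ)(v) = P(γv)`. [cite: Cox2013, §2.A] -/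
theorem eval_vecAct (P : BinQF) (γ : SL(2, ℤ)) (v : ℤ × ℤ) :
    P.eval (vecAct γ v).1 (vecAct γ v).2 = (smul P γ).eval v.1 v.2 := by
  rw [smul, BinQF.eval_act]
  rfl

/-- An automorph of `P` preserves the values of `P`. [folklore] -/
theorem eval_vecAct_of_mem_stab {P : BinQF} {γ : SL(2, ℤ)} (hγ : γ ∈ stab P) (v : ℤ × ℤ) :
    P.eval (vecAct γ v).1 (vecAct γ v).2 = P.eval v.1 v.2 := by
  rw [eval_vecAct, mem_stab_iff.1 hγ]

/-- `SL₂(ℤ)` maps primitive vectors to primitive vectors. [folklore] -/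
theorem gcd_vecAct_eq_one (γ : SL(2, ℤ)) {v : ℤ × ℤ} (hv : Int.gcd v.1 v.2 = 1) :
    Int.gcd (vecAct γ v).1 (vecAct γ v).2 = 1 := by
  rw [← Int.isCoprime_iff_gcd_eq_one] at hv ⊢
  obtain ⟨a, b, hab⟩ := hv
  have hdet : γ 0 0 * γ 1 1 - γ 0 1 * γ 1 0 = 1 := by
    have h := γ.det_coe
    rwa [Matrix.det_fin_two] at h
  refine ⟨a * γ 1 1 - b * γ 1 0, -a * γ 0 1 + b * γ 0 0, ?_⟩
  simp only [vecAct_fst, vecAct_snd]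
  linear_combination hab + (a * v.1 + b * v.2) * hdet

/-- The first column of a matrix of `SL₂(ℤ)` is primitive. [folklore] -/
theorem gcd_col_eq_one (ξ : SL(2, ℤ)) : Int.gcd (ξ 0 0) (ξ 1 0) = 1 := by
  have h := gcd_vecAct_eq_one ξ (v := (1, 0)) (by simp)
  rwa [vecAct_e1] at h

/-! ### Matrices with a given first column differ by a power of `T` -/

/-- Entries of `ξ T^k`: the first column is that of `ξ`, the second is shifted by `k` times the
first. [folklore] -/
theorem mul_T_zpow_apply (ξ : SL(2, ℤ)) (k : ℤ) :
    (ξ * ModularGroup.T ^ k) 0 0 = ξ 0 0 ∧ (ξ * ModularGroup.T ^ k) 1 0 = ξ 1 0 ∧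
      (ξ * ModularGroup.T ^ k) 0 1 = ξ 0 0 * k + ξ 0 1 ∧
      (ξ * ModularGroup.T ^ k) 1 1 = ξ 1 0 * k + ξ 1 1 := by
  have h00 : (ModularGroup.T ^ k) 0 0 = 1 := by
    show (ModularGroup.T ^ k).1 0 0 = 1
    rw [ModularGroup.coe_T_zpow]; rfl
  have h01 : (ModularGroup.T ^ k) 0 1 = k := by
    show (ModularGroup.T ^ k).1 0 1 = k
    rw [ModularGroup.coe_T_zpow]; rfl
  have h10 : (ModularGroup.T ^ k) 1 0 = 0 := by
    show (ModularGroup.T ^ k).1 1 0 = 0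
    rw [ModularGroup.coe_T_zpow]; rfl
  have h11 : (ModularGroup.T ^ k) 1 1 = 1 := by
    show (ModularGroup.T ^ k).1 1 1 = 1
    rw [ModularGroup.coe_T_zpow]; rfl
  refine ⟨?_, ?_, ?_, ?_⟩ <;> simp only [mul_apply_two, h00, h01, h10, h11] <;> ring

/-- **Two matrices of `SL₂(ℤ)` with the same first column differ by a power of `T` on the right.**
[folklore] -/
theorem exists_eq_mul_T_zpow_of_col_eq {ξ ξ' : SL(2, ℤ)} (h0 : ξ' 0 0 = ξ 0 0)
    (h1 : ξ' 1 0 = ξ 1 0) : ∃ k : ℤ, ξ' = ξ * ModularGroup.T ^ k := by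
  have hdet : ξ 0 0 * ξ 1 1 - ξ 0 1 * ξ 1 0 = 1 := by
    have h := ξ.det_coe
    rwa [Matrix.det_fin_two] at h
  have hdet' : ξ' 0 0 * ξ' 1 1 - ξ' 0 1 * ξ' 1 0 = 1 := by
    have h := ξ'.det_coe
    rwa [Matrix.det_fin_two] at h
  refine ⟨ξ 1 1 * ξ' 0 1 - ξ 0 1 * ξ' 1 1, ?_⟩
  obtain ⟨e00, e10, e01, e11⟩ := mul_T_zpow_apply ξ (ξ 1 1 * ξ' 0 1 - ξ 0 1 * ξ' 1 1)
  refine Matrix.SpecialLinearGroup.ext _ _ fun i j => ?_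
  fin_cases i <;> fin_cases j
  · simp only [Fin.zero_eta, Fin.isValue]
    rw [e00, h0]
  · simp only [Fin.zero_eta, Fin.isValue, Fin.mk_one]
    rw [e01]
    rw [h0, h1] at hdet'
    linear_combination (-ξ' 0 1) * hdet + ξ 0 1 * hdet'
  · simp only [Fin.mk_one, Fin.isValue, Fin.zero_eta]
    rw [e10, h1]
  · simp only [Fin.mk_one, Fin.isValue]
    rw [e11]
    rw [h0, h1] at hdet'
    linear_combination (-ξ' 1 1) * hdet + ξ 1 1 * hdet'

/-- A matrix of `SL₂(ℤ)` fixing a form with `A ≠ 0` by a power of `T` is trivial there: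
`Q·T^k = Q → k = 0`. [folklore] -/
theorem T_zpow_eq_zero_of_smul_eq {Q : BinQF} (hA : Q.a ≠ 0) {k : ℤ}
    (h : smul Q (ModularGroup.T ^ k) = Q) : k = 0 := by
  have hb := congrArg BinQF.b h
  rw [smul_T_zpow] at hb
  simp only at hb
  have : 2 * Q.a * k = 0 := by linarith
  rcases mul_eq_zero.1 this with h2 | hk
  · exact absurd (by simpa using h2) hA
  · exact hk

/-! ### The `T`-reduced form attached to a primitive vector -/

/-- **The form attached to a primitive vector**: `vecForm P (p, r) = tred (P · colMatrix p r)`, the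
`T`-reduced translate of `P·ξ` for any `ξ ∈ SL₂(ℤ)` with first column `(p, r)` (for a
non-primitive vector the junk value `P`).  Its first coefficient is `P(p, r)`.
[cite: Hooley1967, §6 (27)–(28)] -/
def vecForm (P : BinQF) (v : ℤ × ℤ) : BinQF :=
  if h : Int.gcd v.1 v.2 = 1 then tred (smul P (colMatrix v.1 v.2 h)) else P

/-- Unfolding `vecForm` at a primitive vector. [folklore] -/
theorem vecForm_eq (P : BinQF) {v : ℤ × ℤ} (h : Int.gcd v.1 v.2 = 1) :
    vecForm P v = tred (smul P (colMatrix v.1 v.2 h)) := by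
  rw [vecForm, dif_pos h]

/-- **`A_{vecForm P v} = P(v)`.** [cite: Hooley1967, §6 (27)] -/
theorem vecForm_a (P : BinQF) {v : ℤ × ℤ} (h : Int.gcd v.1 v.2 = 1) :
    (vecForm P v).a = P.eval v.1 v.2 := by
  rw [vecForm_eq P h, tred_a, smul_a, colMatrix_apply_00, colMatrix_apply_10]

/-- **`tred (P·ξ) = vecForm P (col ξ)`**: the `T`-reduced translate only depends on the first
column. [folklore] -/
theorem tred_smul_eq_vecForm {P : BinQF} (hΔ : ¬ IsSquare P.disc) (ξ : SL(2, ℤ)) :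
    tred (smul P ξ) = vecForm P (ξ 0 0, ξ 1 0) := by
  have hg := gcd_col_eq_one ξ
  rw [vecForm_eq P (v := (ξ 0 0, ξ 1 0)) hg]
  obtain ⟨k, hk⟩ := exists_eq_mul_T_zpow_of_col_eq (ξ := colMatrix (ξ 0 0) (ξ 1 0) hg) (ξ' := ξ)
    (by simp) (by simp)
  conv_lhs => rw [hk]
  rw [smul_mul]
  exact tred_smul_T_zpow (a_ne_zero_of_not_isSquare (not_isSquare_smul_disc hΔ _)) k

/-- `vecForm P v` lies in the class of `P`. [folklore] -/
theorem exists_vecForm_eq_smul (P : BinQF) {v : ℤ × ℤ} (h : Int.gcd v.1 v.2 = 1) :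
    ∃ ξ : SL(2, ℤ), vecForm P v = smul P ξ := by
  rw [vecForm_eq P h, tred, ← smul_mul]
  exact ⟨_, rfl⟩

/-- `vecForm P v` is `T`-reduced (non-square discriminant). [folklore] -/
theorem isTReduced_vecForm {P : BinQF} (hΔ : ¬ IsSquare P.disc) {v : ℤ × ℤ} (h : Int.gcd v.1 v.2 = 1) :
    IsTReduced (vecForm P v) := by
  rw [vecForm_eq P h]
  exact isTReduced_tred (a_ne_zero_of_not_isSquare (not_isSquare_smul_disc hΔ _))

/-- `vecForm P v` has the discriminant of `P`. [folklore] -/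
theorem vecForm_disc (P : BinQF) {v : ℤ × ℤ} (h : Int.gcd v.1 v.2 = 1) :
    (vecForm P v).disc = P.disc := by
  obtain ⟨ξ, hξ⟩ := exists_vecForm_eq_smul P h
  rw [hξ, smul_disc]

/-- **Every `T`-reduced form of the class is attached to a primitive vector**, namely to the first
column of any `ξ` with `Q = P·ξ`, and then `P(v) = A_Q`. [folklore] -/
theorem exists_eq_vecForm_of_isTReduced {P Q : BinQF} (hΔ : ¬ IsSquare P.disc)
    (hQ : ∃ ξ : SL(2, ℤ), Q = smul P ξ) (hT : IsTReduced Q) :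
    ∃ v : ℤ × ℤ, Int.gcd v.1 v.2 = 1 ∧ Q = vecForm P v := by
  obtain ⟨ξ, rfl⟩ := hQ
  refine ⟨(ξ 0 0, ξ 1 0), gcd_col_eq_one ξ, ?_⟩
  rw [← tred_smul_eq_vecForm hΔ ξ,
    tred_eq_self (a_ne_zero_of_not_isSquare (not_isSquare_smul_disc hΔ ξ)) hT]

/-- **The fibres of `vecForm` are the `stab P`-orbits**: for primitive `v, v'`,
`vecForm P v = vecForm P v' ↔ v' = s v` for some automorph `s` of `P`. [folklore] -/
theorem vecForm_eq_vecForm_iff {P : BinQF} (hΔ : ¬ IsSquare P.disc) {v v' : ℤ × ℤ}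
    (hv : Int.gcd v.1 v.2 = 1) (hv' : Int.gcd v'.1 v'.2 = 1) :
    vecForm P v = vecForm P v' ↔ ∃ s ∈ stab P, vecAct s v = v' := by
  rw [vecForm_eq P hv, vecForm_eq P hv']
  constructor
  · intro h
    obtain ⟨s, hs, t, ht, hst⟩ := DoubleCoset.rel_iff.1 (rel_of_tred_smul_eq hΔ h)
    obtain ⟨k, rfl⟩ := Subgroup.mem_zpowers_iff.1 ht
    refine ⟨s, hs, ?_⟩
    have hc := col_mul s (colMatrix v.1 v.2 hv)
    simp only [colMatrix_apply_00, colMatrix_apply_10, Prod.mk.eta] at hc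
    rw [← hc]
    obtain ⟨e00, e10, -, -⟩ := mul_T_zpow_apply (s * colMatrix v.1 v.2 hv) k
    have h0 : (colMatrix v'.1 v'.2 hv') 0 0 = (s * colMatrix v.1 v.2 hv * ModularGroup.T ^ k) 0 0 := by
      rw [hst]
    have h1 : (colMatrix v'.1 v'.2 hv') 1 0 = (s * colMatrix v.1 v.2 hv * ModularGroup.T ^ k) 1 0 := by
      rw [hst]
    rw [colMatrix_apply_00, e00] at h0
    rw [colMatrix_apply_10, e10] at h1
    ext <;> simp [h0, h1]
  · rintro ⟨s, hs, hsv⟩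
    -- `s · col_v` has first column `v'`, hence `col_{v'} = s col_v T^k`
    have hc := col_mul s (colMatrix v.1 v.2 hv)
    simp only [colMatrix_apply_00, colMatrix_apply_10, Prod.mk.eta, hsv] at hc
    obtain ⟨k, hk⟩ := exists_eq_mul_T_zpow_of_col_eq (ξ := s * colMatrix v.1 v.2 hv)
      (ξ' := colMatrix v'.1 v'.2 hv') (by rw [colMatrix_apply_00]; exact (congrArg Prod.fst hc).symm)
      (by rw [colMatrix_apply_10]; exact (congrArg Prod.snd hc).symm)
    rw [hk, smul_mul, smul_mul, mem_stab_iff.1 hs,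
      tred_smul_T_zpow (a_ne_zero_of_not_isSquare (not_isSquare_smul_disc hΔ _))]

/-- **`stab P` acts freely on primitive vectors** (non-square discriminant): an automorph fixing
a primitive `v` is `1` (it is `ξ_v T^k ξ_v⁻¹` and fixes `P·ξ_v`, whose first coefficient is
non-zero). [folklore] -/
theorem eq_one_of_vecAct_eq {P : BinQF} (hΔ : ¬ IsSquare P.disc) {s : SL(2, ℤ)} (hs : s ∈ stab P)
    {v : ℤ × ℤ} (hv : Int.gcd v.1 v.2 = 1) (h : vecAct s v = v) : s = 1 := by
  have hc := col_mul s (colMatrix v.1 v.2 hv)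
  simp only [colMatrix_apply_00, colMatrix_apply_10, Prod.mk.eta, h] at hc
  obtain ⟨k, hk⟩ := exists_eq_mul_T_zpow_of_col_eq (ξ := colMatrix v.1 v.2 hv)
    (ξ' := s * colMatrix v.1 v.2 hv) (by rw [colMatrix_apply_00]; exact (congrArg Prod.fst hc))
    (by rw [colMatrix_apply_10]; exact (congrArg Prod.snd hc))
  -- `P·ξ_v = P·ξ_v·T^k`, so `k = 0`
  have hQ : smul (smul P (colMatrix v.1 v.2 hv)) (ModularGroup.T ^ k) = smul P (colMatrix v.1 v.2 hv) := by
    rw [← smul_mul, ← hk, smul_mul, mem_stab_iff.1 hs]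
  have hk0 := T_zpow_eq_zero_of_smul_eq (a_ne_zero_of_not_isSquare (not_isSquare_smul_disc hΔ _)) hQ
  rw [hk0, zpow_zero, mul_one] at hk
  exact mul_right_cancel (hk.trans (one_mul _).symm)

/-! ### Hooley's fraction formula -/

/-- **Hooley's fraction formula.**  Let `P = [A, B, C]`, `(p, r)` primitive with `r > 0`,
`n = P(p, r) ≠ 0`, and `Q = vecForm P (p, r)` (so `A_Q = n`).  Then for every integer `h`,
`e(h B_Q/(2A_Q)) = e(h p̄/r) · e(−h(2Ap + Br)/(2rn))`, `p p̄ ≡ 1 (mod r)`: with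
`ξ = (p p'; r r')`, `pr' − p'r = 1`, one has `r · B_{P·ξ} = 2r'n − (2Ap + Br)` and `r' ≡ p̄ (mod r)`,
and `B_Q ≡ B_{P·ξ} (mod 2n)`.  This is Hooley's `ν/λk = r̄/s − (ar + bs)/(s(ar² + 2brs + cs²))`
((28) of Acta Math. 117, for the Gaussian form `(a, b, c) = [a, 2b, c]`), here for an arbitrary
middle coefficient; `e(h p̄/r)` is `Iwaniec1978.hooleyPhase h r p`.
[cite: Hooley1967, §6 (28)] -/
theorem exp_vecForm_b_div_eq {P : BinQF} {p r : ℤ} (hv : Int.gcd p r = 1) (hr : 0 < r)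
    (hn : P.eval p r ≠ 0) (h : ℤ) :
    Complex.exp (2 * Real.pi * Complex.I *
        ((h : ℂ) * ((vecForm P (p, r)).b : ℂ) / (2 * ((vecForm P (p, r)).a : ℂ)))) =
      hooleyPhase h r.toNat p *
        Complex.exp (2 * Real.pi * Complex.I *
          (-((h : ℂ) * ((2 * P.a * p + P.b * r : ℤ) : ℂ) / (2 * (r : ℂ) * (P.eval p r : ℂ))))) := by
  set col := colMatrix p r hv with hcol
  set p' : ℤ := col 0 1 with hp'
  set r' : ℤ := col 1 1 with hr'
  have h00 : col 0 0 = p := by rw [hcol, colMatrix_apply_00]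
  have h10 : col 1 0 = r := by rw [hcol, colMatrix_apply_10]
  have hdet : p * r' - p' * r = 1 := by
    have hd := col.det_coe
    rw [Matrix.det_fin_two, h00, h10] at hd
    rw [hp', hr']
    linear_combination hd
  set Q₀ := smul P col with hQ₀
  set k := tExp Q₀ with hk
  set n := P.eval p r with hn'
  have hQ₀a : Q₀.a = n := by rw [hQ₀, smul_a, h00, h10]
  have hQ : vecForm P (p, r) = smul Q₀ (ModularGroup.T ^ k) := by
    rw [vecForm_eq P (v := (p, r)) hv]; rfl
  have hQa : (vecForm P (p, r)).a = n := by rw [hQ, smul_T_zpow_a, hQ₀a]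
  have hQb : (vecForm P (p, r)).b = Q₀.b + 2 * n * k := by
    rw [hQ, smul_T_zpow, hQ₀a]
  have hQ₀b : Q₀.b = 2 * P.a * p * p' + P.b * (p * r' + p' * r) + 2 * P.c * r * r' := by
    rw [hQ₀, smul_b, h00, h10]
  have hid : r * Q₀.b = 2 * r' * n - (2 * P.a * p + P.b * r) := by
    rw [hQ₀b, hn', BinQF.eval]
    linear_combination (-(2 * P.a * p + P.b * r)) * hdet
  -- `r' ≡ p̄ (mod r)`
  set R := r.toNat with hR
  have hRr : (R : ℤ) = r := Int.toNat_of_nonneg hr.le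
  haveI : NeZero R := ⟨by omega⟩
  have hinv : ((p : ZMod R)⁻¹) = (r' : ZMod R) := by
    apply ZMod.inv_eq_of_mul_eq_one
    have h1 : ((p * r' - p' * r : ℤ) : ZMod R) = 1 := by rw [hdet]; simp
    have hr0 : ((r : ℤ) : ZMod R) = 0 := by
      rw [← hRr, Int.cast_natCast, ZMod.natCast_self]
    push_cast at h1
    rw [hr0, mul_zero, sub_zero] at h1
    exact h1
  obtain ⟨m, hm⟩ : ∃ m : ℤ, r' = (((p : ZMod R)⁻¹).val : ℤ) + r * m := by
    refine ⟨r' / r, ?_⟩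
    rw [hinv, ZMod.val_intCast, hRr, Int.emod_def]
    ring
  -- the identity between the phases
  have hrC : (r : ℂ) ≠ 0 := by exact_mod_cast hr.ne'
  have hnC : (n : ℂ) ≠ 0 := by exact_mod_cast hn
  have hRC : (R : ℂ) = (r : ℂ) := by
    have : ((R : ℤ) : ℂ) = (r : ℂ) := by rw [hRr]
    exact_mod_cast this
  have hidC : (r : ℂ) * (Q₀.b : ℂ) = 2 * (r' : ℂ) * n - (2 * P.a * p + P.b * r) := by
    exact_mod_cast hid
  have hmC : (r' : ℂ) = ((((p : ZMod R)⁻¹).val : ℕ) : ℂ) + r * m := by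
    have : ((r' : ℤ) : ℂ) = (((((p : ZMod R)⁻¹).val : ℤ) + r * m : ℤ) : ℂ) := by rw [← hm]
    push_cast at this
    exact this
  set pb : ℂ := ((((p : ZMod R)⁻¹).val : ℕ) : ℂ) with hpb
  have hX : (h : ℂ) * ((vecForm P (p, r)).b : ℂ) / (2 * ((vecForm P (p, r)).a : ℂ)) =
      (h : ℂ) * pb / (R : ℂ) +
        (-((h : ℂ) * ((2 * P.a * p + P.b * r : ℤ) : ℂ) / (2 * (r : ℂ) * (n : ℂ)))) +
          ((h * k + h * m : ℤ) : ℂ) := by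
    rw [hQa, hQb, hRC]
    push_cast
    field_simp
    linear_combination (h : ℂ) * hidC + (2 * (h : ℂ) * n) * hmC
  rw [hX, mul_add, mul_add, Complex.exp_add, Complex.exp_add]
  have hint : Complex.exp (2 * Real.pi * Complex.I * ((h * k + h * m : ℤ) : ℂ)) = 1 := by
    rw [show 2 * Real.pi * Complex.I * ((h * k + h * m : ℤ) : ℂ) =
      ((h * k + h * m : ℤ) : ℂ) * (2 * Real.pi * Complex.I) by ring]
    exact Complex.exp_int_mul_two_pi_mul_I _
  rw [hint, mul_one, hooleyPhase]

/-! ### Counting a class through a fundamental domain of a subgroup of automorphs -/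

/-- **The number of points of an orbit in a fundamental domain.**  Let `G' ≤ stab P` and let
`F ⊆ ℤ²` contain exactly one point of the `G'`-orbit of every `w` with `P(w) > 0`.  Then for
primitive `w, w'` with `P(w), P(w') > 0`, the sets `F ∩ stab P·w` and `F ∩ stab P·w'` (given as
finite sets `T, T'`) have the same number of elements — both are in bijection with `G'∖stab P`,
by the free action of `stab P` on primitive vectors. [folklore] -/
theorem card_orbit_inter_eq {P : BinQF} (hΔ : ¬ IsSquare P.disc) {G' : Subgroup SL(2, ℤ)}
    (hG' : G' ≤ stab P) {F : Set (ℤ × ℤ)}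
    (hF : ∀ w : ℤ × ℤ, 0 < P.eval w.1 w.2 → ∃! v, v ∈ F ∧ ∃ s ∈ G', v = vecAct s w)
    {w w' : ℤ × ℤ} (hw : Int.gcd w.1 w.2 = 1) (hw' : Int.gcd w'.1 w'.2 = 1)
    (hPw : 0 < P.eval w.1 w.2) (hPw' : 0 < P.eval w'.1 w'.2) {T T' : Finset (ℤ × ℤ)}
    (hT : ∀ v, v ∈ T ↔ v ∈ F ∧ ∃ γ ∈ stab P, v = vecAct γ w)
    (hT' : ∀ v, v ∈ T' ↔ v ∈ F ∧ ∃ γ ∈ stab P, v = vecAct γ w') :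
    T.card = T'.card := by
  classical
  -- the `F`-representative of the `G'`-orbit of `x` (for `P(x) > 0`)
  let rep : ℤ × ℤ → ℤ × ℤ := fun x =>
    if hx : 0 < P.eval x.1 x.2 then (hF x hx).choose else x
  have rep_spec : ∀ x : ℤ × ℤ, 0 < P.eval x.1 x.2 → rep x ∈ F ∧ ∃ s ∈ G', rep x = vecAct s x := by
    intro x hx
    simp only [rep, dif_pos hx]
    exact (hF x hx).choose_spec.1
  have rep_eq : ∀ x v : ℤ × ℤ, 0 < P.eval x.1 x.2 → v ∈ F → (∃ s ∈ G', v = vecAct s x) →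
      rep x = v := by
    intro x v hx hvF hv
    exact ((hF x hx).unique (rep_spec x hx) ⟨hvF, hv⟩)
  have rep_smul : ∀ (x : ℤ × ℤ) (g : SL(2, ℤ)), g ∈ G' → 0 < P.eval x.1 x.2 →
      rep (vecAct g x) = rep x := by
    intro x g hg hx
    have hgx : 0 < P.eval (vecAct g x).1 (vecAct g x).2 := by
      rwa [eval_vecAct_of_mem_stab (hG' hg)]
    obtain ⟨hF1, s, hs, hs'⟩ := rep_spec x hx
    refine rep_eq _ _ hgx hF1 ⟨s * g⁻¹, G'.mul_mem hs (G'.inv_mem hg), ?_⟩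
    rw [vecAct_mul, vecAct_inv_vecAct]
    exact hs'
  -- freeness: the automorph carrying a primitive `x` to a point of its orbit is unique
  have huniq : ∀ (x : ℤ × ℤ), Int.gcd x.1 x.2 = 1 → ∀ γ γ' : SL(2, ℤ), γ ∈ stab P → γ' ∈ stab P →
      vecAct γ x = vecAct γ' x → γ = γ' := by
    intro x hx γ γ' hγ hγ' he
    have h1 : vecAct (γ'⁻¹ * γ) x = x := by rw [vecAct_mul, he, vecAct_inv_vecAct]
    have := eq_one_of_vecAct_eq hΔ ((stab P).mul_mem ((stab P).inv_mem hγ') hγ) hx h1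
    calc γ = γ' * (γ'⁻¹ * γ) := by group
      _ = γ' := by rw [this, mul_one]
  let aut : ℤ × ℤ → ℤ × ℤ → SL(2, ℤ) := fun x v =>
    if hx : ∃ γ ∈ stab P, v = vecAct γ x then hx.choose else 1
  have aut_spec : ∀ x v : ℤ × ℤ, (∃ γ ∈ stab P, v = vecAct γ x) →
      aut x v ∈ stab P ∧ v = vecAct (aut x v) x := by
    intro x v hx
    simp only [aut, dif_pos hx]
    exact hx.choose_spec
  have aut_eq : ∀ x v : ℤ × ℤ, Int.gcd x.1 x.2 = 1 → ∀ γ ∈ stab P, v = vecAct γ x →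
      aut x v = γ := by
    intro x v hx γ hγ hv
    obtain ⟨h1, h2⟩ := aut_spec x v ⟨γ, hγ, hv⟩
    exact huniq x hx _ _ h1 hγ (h2.symm.trans hv)
  -- the map `v = γ x ↦ rep (γ y)` sends `F ∩ stab P·x` to `F ∩ stab P·y`, inverse to its swap
  have key : ∀ (x y : ℤ × ℤ), Int.gcd x.1 x.2 = 1 → Int.gcd y.1 y.2 = 1 →
      0 < P.eval x.1 x.2 → 0 < P.eval y.1 y.2 →
      ∀ v : ℤ × ℤ, (v ∈ F ∧ ∃ γ ∈ stab P, v = vecAct γ x) →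
        (rep (vecAct (aut x v) y) ∈ F ∧ ∃ γ ∈ stab P, rep (vecAct (aut x v) y) = vecAct γ y) ∧
          rep (vecAct (aut y (rep (vecAct (aut x v) y))) x) = v := by
    intro x y hx hy hPx hPy v ⟨hvF, hv⟩
    obtain ⟨haut, hvaut⟩ := aut_spec x v hv
    have hPy' : 0 < P.eval (vecAct (aut x v) y).1 (vecAct (aut x v) y).2 := by
      rwa [eval_vecAct_of_mem_stab haut]
    obtain ⟨hrF, s, hs, hsr⟩ := rep_spec _ hPy'
    have hmem : (s * aut x v) ∈ stab P := (stab P).mul_mem (hG' hs) haut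
    have hsr' : rep (vecAct (aut x v) y) = vecAct (s * aut x v) y := by
      rw [vecAct_mul]; exact hsr
    refine ⟨⟨hrF, s * aut x v, hmem, hsr'⟩, ?_⟩
    have haut2 : aut y (rep (vecAct (aut x v) y)) = s * aut x v := aut_eq y _ hy _ hmem hsr'
    have hPv : 0 < P.eval v.1 v.2 := by rw [hvaut, eval_vecAct_of_mem_stab haut]; exact hPx
    rw [haut2, vecAct_mul, ← hvaut, rep_smul _ _ hs hPv]
    exact rep_eq v v hPv hvF ⟨1, G'.one_mem, (vecAct_one v).symm⟩
  refine Finset.card_nbij' (fun v => rep (vecAct (aut w v) w')) (fun v => rep (vecAct (aut w' v) w))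
    (fun v hv => (hT' _).2 (key w w' hw hw' hPw hPw' v ((hT v).1 hv)).1)
    (fun v hv => (hT _).2 (key w' w hw' hw hPw' hPw v ((hT' v).1 hv)).1)
    (fun v hv => (key w w' hw hw' hPw hPw' v ((hT v).1 hv)).2)
    (fun v hv => (key w' w hw' hw hPw' hPw v ((hT' v).1 hv)).2)

/-- **A class sum as a sum over primitive vectors in a fundamental domain.**  Let `P` have
non-square discriminant, `S` be the set of `T`-reduced forms of the class of `P` with
`0 < A ≤ N`, `V` the set of primitive `v ∈ F` with `0 < P(v) ≤ N`, and suppose every orbit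
`stab P · w` (`w` primitive, `0 < P(w) ≤ N`) meets `V` in exactly `m` points (any finite set `T`
with `T = V ∩ stab P·w` has `m` elements).  Then
`∑_{v ∈ V} f(vecForm P v) = m · ∑_{Q ∈ S} f(Q)` (the fibre of `vecForm` over `Q ∈ S` is the orbit
of any of its vectors, `vecForm_eq_vecForm_iff`).  With `F` a fundamental domain as in
`card_orbit_inter_eq` the hypothesis holds with `m` the common multiplicity.
[cite: Hooley1967, §6 (30)] -/
theorem sum_vecForm_eq_card_mul_sum {P : BinQF} (hΔ : ¬ IsSquare P.disc) {N : ℕ}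
    {S : Finset BinQF}
    (hS : ∀ Q, Q ∈ S ↔ (∃ ξ : SL(2, ℤ), Q = smul P ξ) ∧ IsTReduced Q ∧ 0 < Q.a ∧ Q.a ≤ N)
    {F : Set (ℤ × ℤ)} {V : Finset (ℤ × ℤ)}
    (hV : ∀ v, v ∈ V ↔ v ∈ F ∧ Int.gcd v.1 v.2 = 1 ∧ 0 < P.eval v.1 v.2 ∧ P.eval v.1 v.2 ≤ N)
    {m : ℕ}
    (hm : ∀ w : ℤ × ℤ, Int.gcd w.1 w.2 = 1 → 0 < P.eval w.1 w.2 → P.eval w.1 w.2 ≤ N →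
      ∀ T : Finset (ℤ × ℤ), (∀ v, v ∈ T ↔ v ∈ V ∧ ∃ γ ∈ stab P, v = vecAct γ w) → T.card = m)
    (f : BinQF → ℂ) :
    ∑ v ∈ V, f (vecForm P v) = (m : ℂ) * ∑ Q ∈ S, f Q := by
  classical
  have hmaps : ∀ v ∈ V, vecForm P v ∈ S := by
    intro v hv
    obtain ⟨-, hg, hP0, hPN⟩ := (hV v).1 hv
    exact (hS _).2 ⟨exists_vecForm_eq_smul P hg, isTReduced_vecForm hΔ hg,
      by rw [vecForm_a P hg]; exact hP0, by rw [vecForm_a P hg]; exact hPN⟩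
  rw [← Finset.sum_fiberwise_of_maps_to hmaps, Finset.mul_sum]
  refine Finset.sum_congr rfl fun Q hQ => ?_
  obtain ⟨hcl, hT, hA0, hAN⟩ := (hS Q).1 hQ
  obtain ⟨w, hw, hwQ⟩ := exists_eq_vecForm_of_isTReduced hΔ hcl hT
  have hPw : P.eval w.1 w.2 = Q.a := by rw [hwQ, vecForm_a P hw]
  have hfib : V.filter (fun v => vecForm P v = Q) =
      V.filter (fun v => ∃ γ ∈ stab P, v = vecAct γ w) := by
    refine Finset.filter_congr fun v hv => ?_
    obtain ⟨-, hg, -, -⟩ := (hV v).1 hv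
    rw [hwQ, eq_comm, vecForm_eq_vecForm_iff hΔ hw hg]
    exact exists_congr fun γ => and_congr_right fun _ => eq_comm
  rw [Finset.sum_congr rfl (fun v hv => by rw [(Finset.mem_filter.1 hv).2]), Finset.sum_const, hfib,
    hm w hw (by rw [hPw]; exact hA0) (by rw [hPw]; exact hAN) _ (fun v => by rw [Finset.mem_filter]),
    nsmul_eq_mul]

end RootForms

end Literature.NumberTheory.Sieve

end
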